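import Literature.AlgebraicGeometry.AbelianSchemes.ClassifyOfAffineFiniteTypeOfNoetherian
import Literature.AlgebraicGeometry.AbelianSchemes.AbelianSchemeKOfL
import Literature.AlgebraicGeometry.AbelianSchemes.AbelianSchemeDualPairNormalize
import Mathlib.FieldTheory.IsAlgClosed.Basic
import HarnessLib

/-!
# F-3 (M) grandchild line `Cruxes/HDel/Lines/F3DualAbelianSchemeMc` — the letter (N0′) `stub_McN0` PROVED
# («affine finite type ⇒ all `T → S′`», [MumfordAV1970] §13, the reduction in the proof of the Theorem p. 125)

Cell `hodgecm-mathlib` (D-0151 / D-0183 FLOOR 0), programme P1, sub-line F-3, child (M), grandchild line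
`Cruxes/HDel/Lines/F3DualAbelianSchemeMc.lean` (skeleton v2 49bc8eda, registered 2026-08-30T21:35Z), node **N0′** (:238).
HC_CM is proved only modulo the 7 printed citations until rung 0 closes; nothing in this file is about HC.

`stub_McN0_holds` restates the tree letter `Summit.HodgeConjecture.CorCM.Cruxes.HypDel.F3DualAbelianSchemeMc.stub_McN0` TOKEN FOR
TOKEN and proves it in three lines over ★ `AbelianSchemes/ClassifyOfAffineFiniteTypeOfNoetherian`
(`existsUnique_classify_of_affine_finiteType_of_isAffine`: (0d) «affine finite type ⇒ affine» by Noetherian approximation over the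
ring base `Γ(S′, 𝒪)` transported along `S′ ≅ Spec Γ(S′, 𝒪)`, with the closedness of the `Pic⁰` locus supplied by `K(L)`; (0b)(0c)
«affine ⇒ all» by Zariski gluing, ★ `ClassifyOfAffineOfNoetherian`); `S′` is locally Noetherian because `p : S′ → Spec R` is
locally of finite type over the Noetherian `R` (Mathlib `LocallyOfFiniteType.isLocallyNoetherian`).  Only the binders `p`, `hat`,
`P`, `_h1`, `_hrig` and the affine-finite-type hypothesis are used (the other letters' binders are carried for byte-identity with the
line's composition `stub_F3Mc_holds`).

## References
* [MumfordAV1970] D. Mumford, *Abelian Varieties* (1970), §13 (Thm. p. 125 and its proof).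
* [GortzWedhorn2023] U. Görtz, T. Wedhorn, *Algebraic Geometry II* (2023), (27.41) eq. (27.41.1) and Def. 27.216 (pp. 688–689).
* [MilneAV2008] J. S. Milne, *Abelian Varieties* (v2.00, 2008), I §8 pp. 36–37.
-/

noncomputable section

open CategoryTheory CategoryTheory.Limits AlgebraicGeometry MonoidalCategory CartesianMonoidalCategory
open scoped MonObj
open Literature.AlgebraicGeometry.AbelianSchemes Literature.AlgebraicGeometry.RelativeSpec
  Literature.AlgebraicGeometry.Motives Literature.AlgebraicGeometry.AbelianVarieties Literature.AlgebraicGeometry.Modules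

namespace Summit.HodgeConjecture.CorCM.Cruxes.HypDel.F3DualAbelianSchemeMc

/-- **(N0′) `stub_McN0` PROVED — «AFFINE FINITE TYPE ⇒ ALL `T → S′`»**: the universal property of `(Â′, 𝒫′)` over every
`T → S′` follows from the universal property over the affine `T → S′` of finite type, by Noetherian approximation of affine test
schemes ([MumfordAV1970] §13 «it suffices to consider `T` of finite type»; the `Pic⁰` condition descends to a finite-type stage because
the `Pic⁰` locus of a rigidified family on an abelian scheme over a Noetherian affine base is closed, via the closed subscheme `K(L)`)
and Zariski locality of the `∃!` ([MilneAV2008] I §8 Thm. 8.9; rigidified gluing holds since `A′_T → T` is Stein for every `T`,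
[GortzWedhorn2023] Cor. 24.63) — ★ `AbelianSchemeOver.existsUnique_classify_of_affine_finiteType_of_isAffine` at `A′ = A ×_R S′`,
`B = hat`, `𝒫 = P`; the statement is the tree letter `stub_McN0` of `Cruxes/HDel/Lines/F3DualAbelianSchemeMc.lean` token for token.
[cite: MumfordAV1970, §13 (Thm. p. 125 and its proof)] [cite: GortzWedhorn2023, (27.41) eq. (27.41.1) and Def. 27.216 (pp. 688–689)]
[cite: MilneAV2008, I §8 (Thm. 8.9, pp. 36–37)] -/
theorem stub_McN0_holds : ∀ (R : Type) [CommRing R] [IsNoetherianRing R] [Algebra ℚ R] (A : AbelianSchemeOver (Spec (.of R)))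
    (L : A.left.Modules) (hL : HasRank L 1)
    (_hε : CechPic.pullback A.unitSection (detClass (HasRank.isFiniteLocallyFree' hL)) = 1)
    (_hΘ : ∀ ⦃Ω : Type⦄ [Field Ω] [IsAlgClosed Ω] (s : Spec (.of Ω) ⟶ Spec (.of R)),
      ∃ Θ : CartierDivisor (A.fibre s).toAbelianVariety.X.left, Θ.IsAmple ∧
        CechPic.pullback (X := (A.fibre s).toAbelianVariety.X.left) (pullback.fst A.X.hom s)
          (detClass (HasRank.isFiniteLocallyFree' hL)) = Θ.cechClass)
    {S' : Scheme.{0}} [IsAffine S'] (p : S' ⟶ Spec (.of R)) [IsFinite p] [Etale p] [Surjective p]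
    (hat : AbelianSchemeOver S') (π : (A.baseChange p).X ⟶ hat.X) [IsMonHom π]
    (_hπ : IsFinite π.left ∧ Etale π.left ∧ Surjective π.left)
    (P : ((A.baseChange p).prodLeft hat).Modules)
    (_hker : ∀ (T : Over S') (u : T ⟶ (A.baseChange p).X),
      u ≫ π = 1 ↔ (A.baseChange p).MemKOfL ((Scheme.Modules.pullback (pullback.fst A.X.hom p)).obj L) u)
    (_h1 : HasRank P 1)
    (_hrig : Nonempty ((Scheme.Modules.pullback ((A.baseChange p).unitSlice hat)).obj P ≅ SheafOfModules.unit _))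
    (_hsock : Nonempty ((Scheme.Modules.pullback ((A.baseChange p).X ◁ π).left).obj P ≅
      (A.baseChange p).mumfordBundle ((Scheme.Modules.pullback (pullback.fst A.X.hom p)).obj L))),
    (∀ {T : Scheme.{0}} (f : T ⟶ S') [IsAffine T] [LocallyOfFiniteType f]
      (ℒ : (A.baseChange p).RigidifiedLineBundle f), ℒ.FibrewisePicZero →
      ∃! g : {g : T ⟶ hat.X.left // g ≫ hat.X.hom = f},
        Nonempty ((Scheme.Modules.pullback ((A.baseChange p).baseChangeToProd hat f g.1 g.2)).obj P ≅ ℒ.L)) →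
    ∀ {T : Scheme.{0}} (f : T ⟶ S') (ℒ : (A.baseChange p).RigidifiedLineBundle f), ℒ.FibrewisePicZero →
      ∃! g : {g : T ⟶ hat.X.left // g ≫ hat.X.hom = f},
        Nonempty ((Scheme.Modules.pullback ((A.baseChange p).baseChangeToProd hat f g.1 g.2)).obj P ≅ ℒ.L) := by
  intro R _ _ _ A L hL _hε _hΘ S' _ p _ _ _ hat π _ _hπ P _hker h1 hrig _hsock haff T f ℒ hℒ
  haveI : IsLocallyNoetherian S' := LocallyOfFiniteType.isLocallyNoetherian p
  exact (A.baseChange p).existsUnique_classify_of_affine_finiteType_of_isAffine hat P h1 hrig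
    (fun T' _ f' _ ℒ' hℒ' => haff f' ℒ' hℒ') f ℒ hℒ

end Summit.HodgeConjecture.CorCM.Cruxes.HypDel.F3DualAbelianSchemeMc

end
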